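import Summits.KontsevichZagierPeriods.KontsevichZagierPeriods.Theorems.MzvKernelInKZ.Negative.CalabiFourOnto
import Summits.KontsevichZagierPeriods.KontsevichZagierPeriods.Theorems.MzvKernelInKZ.Negative.ZetaTwo
import Summits.KontsevichZagierPeriods.KontsevichZagierPeriods.Theorems.MzvKernelInKZ.Negative.ShuffleFour

/-!
# `MzvKernelInKZ` (stmt-KontsevichZagierPeriods-3914): negative side — Euler’s `3ζ(4) = 4ζ(2,2)` is a move chain; THE WEIGHT-4 RUNG HOLDS

Companion of `Negative/CalabiFourOnto.lean`, `Negative/ZetaTwo.lean`, `Negative/StuffleFour.lean`,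
`Negative/ShuffleFour.lean`.  The `ζ(4)` side: `1/(1−P) = 1/(1−P²) + P/(1−P²)` (`P = abcd`,
rule (1b)), the squaring map `xᵢ ↦ xᵢ²` carrying the even part onto `(1/16)·[□⁴, 1/(1−abcd)]`
(rule (2), Jacobian `16abcd`), scaling: **`45 • [□⁴, 1/(1−abcd)] − 8 • [Q⁴] ∈ KZ.relations`**
(`fortyfive_C4_sub_eight_G4_mem`, Euler's `ζ(4) = π⁴/90` in the calculus).  ASSEMBLY: with
`3[ζ(2)] ≡ 2[Q²]` (squared in the formal ring: `9[ζ(2)]² ≡ 4[Q⁴]`, ideal property of relations),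
the stuffle `[ζ(2)]² ≡ 2[ζ(2,2)] + [ζ(4)]`, the cubical chart `[□⁴, 1/(1−abcd)] ≡ [ζ(4)]` and
integer division (`ScalingDivision.lean`): **EULER'S EVALUATION `3ζ(4) = 4ζ(2,2)` IS A KZ MOVE
CHAIN** (`cEuler4_mem_relations`), hence Hoffman's relation too (`cHoffman4_mem_relations`, the
weight-4 instance of crux HoffmanRelationInKZ, stmt-3930) and **THE WEIGHT-4 RUNG OF THE CRUX
`MzvKernelInKZ` HOLDS UNCONDITIONALLY** (`weightKernel_four : WeightKernel 4`): every
`ℤ`-combination of weight-4 MZV word representations with value `0` is a KZ relation, every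
intermediate representation being rational or real-algebraic and absolutely convergent — no
regularisation is needed at weight 4 (the route's pressure point (a)).

Sources: F. Beukers, J. A. C. Kolk, E. Calabi, *Sums of generalized harmonic series and volumes*, Nieuw Arch. Wisk. (4) 11 (1993), 217–224; L. Euler (1735); M. E. Hoffman, *Multiple harmonic series*, Pacific J. Math. 152
(1992); M. Kontsevich, D. Zagier, *Periods* (2001), §1.2.
-/

noncomputable section

namespace Summit.KontsevichZagierPeriods.MzvKernelInKZ.Negative

open Set MeasureTheory MvPolynomial
open Literature.NumberTheory.Transcendental
open Literature.ModelTheory.ExponentialFields (IsSemialgebraic)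

/-- `[□⁴, abcd/(1−a²b²c²d²)] = [□⁴, 1/(1−abcd) − 1/(1−a²b²c²d²)]` (the even part of `ζ(4)`). [folklore] -/
def M4rep : KZ.IntegralRep 4 :=
  ⟨openUnitCube 4, fun x => f4 x - L4rep.integrand x, isSemialgebraic_openUnitCube,
    IsSemialgebraicFunOn.sub_holds isSemialgebraicFunOn_f4 L4rep.isSemialgebraicFunOn_integrand,
    integrableOn_f4.sub L4rep.integrableOn⟩

/-- `[□⁴, 1/(1−abcd)] − [□⁴, 1/(1−(abcd)²)] − [□⁴, abcd/(1−(abcd)²)]`: ONE integrand additivity. [folklore] -/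
theorem C4_split_mem : KZ.of C4 - KZ.of L4rep - KZ.of M4rep ∈ KZ.integrandAddRel :=
  ⟨4, C4, L4rep, M4rep, rfl, rfl, fun x _ => by simp [M4rep, C4], rfl⟩

/-- The squaring map in dimension 4. [folklore] -/
def sq4 (x : Fin 4 → ℝ) : Fin 4 → ℝ := ![x 0 * x 0, x 1 * x 1, x 2 * x 2, x 3 * x 3]

/-- Its derivative `diag(2xᵢ)`. [folklore] -/
def sq4Deriv (x : Fin 4 → ℝ) : (Fin 4 → ℝ) →L[ℝ] (Fin 4 → ℝ) :=
  LinearMap.toContinuousLinearMap (Matrix.toLin' !![2 * x 0, 0, 0, 0; 0, 2 * x 1, 0, 0; 0, 0, 2 * x 2, 0; 0, 0, 0, 2 * x 3])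

/-- The determinant of `sq4Deriv`. [folklore] -/
theorem det_sq4Deriv (x : Fin 4 → ℝ) : (sq4Deriv x).det = 16 * (x 0 * x 1 * x 2 * x 3) := by
  have h : (!![2 * x 0, 0, 0, 0; 0, 2 * x 1, 0, 0; 0, 0, 2 * x 2, 0; 0, 0, 0, 2 * x 3] :
      Matrix (Fin 4) (Fin 4) ℝ).det = 16 * (x 0 * x 1 * x 2 * x 3) := by
    simp [Matrix.det_succ_row_zero, Fin.sum_univ_succ]; ring
  rw [← h]; exact LinearMap.det_toLin' _

/-- Differentiability of `sq4` with the stated derivative. [folklore] -/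
theorem hasFDerivAt_sq4 (x : Fin 4 → ℝ) : HasFDerivAt sq4 (sq4Deriv x) x := by
  have p : ∀ i : Fin 4, HasFDerivAt (fun y : Fin 4 → ℝ => y i)
      (ContinuousLinearMap.proj (R := ℝ) (φ := fun _ : Fin 4 => ℝ) i) x := fun i => hasFDerivAt_apply i x
  have c : ∀ i : Fin 4, HasFDerivAt (fun y : Fin 4 → ℝ => y i * y i) ((ContinuousLinearMap.proj i).comp (sq4Deriv x)) x := by
    intro i
    refine ((p i).mul (p i)).congr_fderiv ?_
    ext v
    fin_cases i <;> simp [sq4Deriv, dotProduct, Fin.sum_univ_four] <;> ring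
  rw [hasFDerivAt_pi']
  intro i; fin_cases i
  · exact c 0
  · exact c 1
  · exact c 2
  · exact c 3

/-- `sq4` is injective on its domain. [folklore] -/
theorem injOn_sq4 : InjOn sq4 (openUnitCube 4) := by
  intro x hx y hy h
  rw [mem_cube4'] at hx hy
  funext i
  have e : x i * x i = y i * y i := by
    fin_cases i
    · simpa [sq4] using congrFun h 0
    · simpa [sq4] using congrFun h 1
    · simpa [sq4] using congrFun h 2
    · simpa [sq4] using congrFun h 3
  nlinarith [(hx i).1, (hy i).1]

/-- The image of the domain under `sq4`. [folklore] -/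
theorem image_sq4 : sq4 '' openUnitCube 4 = openUnitCube 4 := by
  apply Subset.antisymm
  · rintro _ ⟨x, hx, rfl⟩
    rw [mem_cube4'] at hx ⊢
    intro i
    have key : ∀ j, 0 < x j * x j ∧ x j * x j < 1 := fun j => ⟨mul_pos (hx j).1 (hx j).1, by nlinarith [(hx j).1, (hx j).2]⟩
    fin_cases i
    · simpa [sq4] using key 0
    · simpa [sq4] using key 1
    · simpa [sq4] using key 2
    · simpa [sq4] using key 3
  · intro w hw
    rw [mem_cube4'] at hw
    have key : ∀ j, 0 < Real.sqrt (w j) ∧ Real.sqrt (w j) < 1 := fun j =>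
      ⟨Real.sqrt_pos.mpr (hw j).1, (Real.sqrt_lt' one_pos).mpr (by simpa using (hw j).2)⟩
    refine ⟨![Real.sqrt (w 0), Real.sqrt (w 1), Real.sqrt (w 2), Real.sqrt (w 3)], ?_, ?_⟩
    · rw [mem_cube4']
      intro i; fin_cases i
      · simpa using key 0
      · simpa using key 1
      · simpa using key 2
      · simpa using key 3
    · funext i; fin_cases i
      · simp [sq4, Real.mul_self_sqrt (hw 0).1.le]
      · simp [sq4, Real.mul_self_sqrt (hw 1).1.le]
      · simp [sq4, Real.mul_self_sqrt (hw 2).1.le]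
      · simp [sq4, Real.mul_self_sqrt (hw 3).1.le]

/-- `sq4` is a `ℚ`-semialgebraic map on its domain (rational or polynomial components). [folklore] -/
theorem isSemialgebraicMapOn_sq4 : IsSemialgebraicMapOn ℚ (openUnitCube 4) sq4 := by
  have h := isSemialgebraicMapOn_aeval (isSemialgebraic_openUnitCube (d := 4))
    (![X 0 * X 0, X 1 * X 1, X 2 * X 2, X 3 * X 3] : Fin 4 → MvPolynomial (Fin 4) ℚ)
  refine h.congr fun x _ => ?_
  funext j; fin_cases j <;> simp [sq4]

/-- `1/16` is algebraic. [folklore] -/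
theorem isAlgebraic_sixteenth : IsAlgebraic ℚ ((1 / 16 : ℚ) : ℝ) := isAlgebraic_algebraMap _

/-- `[□⁴, (1/16) · 1/(1−abcd)]`. [folklore] -/
def C4q : KZ.IntegralRep 4 := C4.constMul ((1 / 16 : ℚ) : ℝ) isAlgebraic_sixteenth

/-- **The even part is a sixteenth of `ζ(4)`, by ONE change of variables** `xᵢ ↦ xᵢ²`. [folklore] -/
theorem M4rep_sub_C4q_mem_cov : KZ.of M4rep - KZ.of C4q ∈ KZ.changeOfVariablesRel := by
  refine ⟨4, M4rep, C4q, sq4, fun x => sq4Deriv x, isSemialgebraicMapOn_sq4,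
    fun x _ => (hasFDerivAt_sq4 x).hasFDerivWithinAt, injOn_sq4, image_sq4.symm, fun x hx => ?_, rfl⟩
  obtain ⟨h0, h1, h2, h3, -, -, -, -, -, -, p⟩ := cube_facts hx
  have pp : 0 < x 0 * x 1 * x 2 * x 3 := by positivity
  rw [det_sq4Deriv, abs_of_pos (by positivity)]
  change f4 x - 1 / (1 - x 0 ^ 2 * x 1 ^ 2 * x 2 ^ 2 * x 3 ^ 2) = ((1 / 16 : ℚ) : ℝ) * f4 (sq4 x) * (16 * (x 0 * x 1 * x 2 * x 3))
  simp only [f4, sq4, Matrix.cons_val_zero, Matrix.cons_val_one, Matrix.cons_val]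
  have n1 : (1 : ℝ) - x 0 * x 1 * x 2 * x 3 ≠ 0 := by linarith
  have lt2 : (x 0 * x 1 * x 2 * x 3) * (x 0 * x 1 * x 2 * x 3) < 1 := by nlinarith
  have n2 : (1 : ℝ) - x 0 ^ 2 * x 1 ^ 2 * x 2 ^ 2 * x 3 ^ 2 ≠ 0 := by nlinarith
  have n3 : (1 : ℝ) - x 0 * x 0 * (x 1 * x 1) * (x 2 * x 2) * (x 3 * x 3) ≠ 0 := by nlinarith
  simp
  field_simp
  ring

/-- `16 · [□⁴, (1/16) f] ≡ [□⁴, f]`. [folklore] -/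
theorem sixteen_C4q_sub_C4_mem : 16 • KZ.of C4q - KZ.of C4 ∈ KZ.relations := by
  have h1 := scale_nat_sub_nsmul_mem 16 (KZ.of C4q)
  rw [KZ.scale_of] at h1
  have h2 : KZ.of ((C4q).constMul ((16 : ℕ) : ℝ) (isAlgebraic_natCast 16)) - KZ.of C4 ∈ KZ.relations :=
    of_sub_of_mem_relations_of_eqOn rfl fun x _ => by
      simp only [KZ.IntegralRep.integrand_constMul, C4q]; push_cast; ring
  have : 16 • KZ.of C4q - KZ.of C4 = -(KZ.of ((C4q).constMul ((16 : ℕ) : ℝ) (isAlgebraic_natCast 16)) -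
      16 • KZ.of C4q) + (KZ.of ((C4q).constMul ((16 : ℕ) : ℝ) (isAlgebraic_natCast 16)) - KZ.of C4) := by abel
  rw [this]
  exact add_mem (neg_mem h1) h2

/-- **`45·[□⁴, 1/(1−abcd)] ≡ 8·Q⁴`** — Euler's `ζ(4) = π⁴/90` inside the calculus (`Q⁴ = (π/2)⁴`). [folklore] -/
theorem fortyfive_C4_sub_eight_G4_mem : 45 • KZ.of C4 - 8 • KZ.of G4 ∈ KZ.relations := by
  have h1 := KZ.integrandAddRel_subset_relations C4_split_mem
  have h2 := KZ.changeOfVariablesRel_subset_relations M4rep_sub_C4q_mem_cov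
  have h3 := sixteen_C4q_sub_C4_mem
  have h4 := of_G4_sub_six_L4rep_mem
  -- 15 C4 − 16 L4 = 16(C4 − L4 − M4) + 16(M4 − C4q) + (16 C4q − C4); 45 C4 − 8 G4 = 3·that − 8(G4 − 6 L4)
  have : 45 • KZ.of C4 - 8 • KZ.of G4 =
      3 • (16 • (KZ.of C4 - KZ.of L4rep - KZ.of M4rep) + 16 • (KZ.of M4rep - KZ.of C4q) + (16 • KZ.of C4q - KZ.of C4))
        - 8 • (KZ.of G4 - 6 • KZ.of L4rep) := by
    abel
  rw [this]
  exact sub_mem (KZ.relations.nsmul_mem (add_mem (add_mem (KZ.relations.nsmul_mem h1 16)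
    (KZ.relations.nsmul_mem h2 16)) h3) 3) (KZ.relations.nsmul_mem h4 8)

/-- `[Δ, n·ω_ε] ≡ n · [Δ, ω_ε]`. [folklore] -/
theorem of_wordRep_nat {w : ℕ} (ε : Fin w → Bool) (hε : Adm ε) (n : ℕ) :
    KZ.of (wordRep ε n hε) - n • KZ.of (wordRep ε 1 hε) ∈ KZ.relations := by
  have h1 : KZ.of (wordRep ε n hε) - KZ.of ((wordRep ε 1 hε).constMul (n : ℝ) (isAlgebraic_natCast n)) ∈
      KZ.relations :=
    of_sub_of_mem_relations_of_eqOn rfl fun t _ => by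
      rw [wordRep_integrand, KZ.IntegralRep.integrand_constMul, wordRep_integrand, wordFun_eq_mul_wordFun_one]
      simp
  have h2 := of_constMul_nat_sub_nsmul_mem n (wordRep ε 1 hε)
  have : KZ.of (wordRep ε n hε) - n • KZ.of (wordRep ε 1 hε) =
      (KZ.of (wordRep ε n hε) - KZ.of ((wordRep ε 1 hε).constMul (n : ℝ) (isAlgebraic_natCast n))) +
      (KZ.of ((wordRep ε 1 hε).constMul (n : ℝ) (isAlgebraic_natCast n)) - n • KZ.of (wordRep ε 1 hε)) := by abel
  rw [this]
  exact add_mem h1 h2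

/-- **EULER'S EVALUATION `3ζ(4) = 4ζ(2,2)` IS A KZ MOVE CHAIN**: `cEuler4 ∈ KZ.relations`.  The chain
passes through `ζ(2)² = (4/9)(π/2)⁴` (the Beukers–Kolk–Calabi change of variables in the rational
half-angle parametrisation, dissections and reflections of the Calabi polytopes, the squaring
maps) and `ζ(4) = (8/45)(π/2)⁴`, the stuffle `ζ(2)² = 2ζ(2,2) + ζ(4)`, and integer division (a
derived rule); every intermediate representation is rational or algebraic and absolutely convergent. [folklore] -/
theorem cEuler4_mem_relations : cEuler4 ∈ KZ.relations := by
  -- names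
  have hW4 : KZ.of (wordRep ω4 3 adm_ω4) - 3 • KZ.of (wordRep ω4 1 adm_ω4) ∈ KZ.relations := by
    simpa using of_wordRep_nat ω4 adm_ω4 3
  have hW22 : KZ.of (wordRep ω22 4 adm_ω22) - 4 • KZ.of (wordRep ω22 1 adm_ω22) ∈ KZ.relations := by
    simpa using of_wordRep_nat ω22 adm_ω22 4
  have hW22' : KZ.of (wordRep ω22 2 adm_ω22) - 2 • KZ.of (wordRep ω22 1 adm_ω22) ∈ KZ.relations := by
    simpa using of_wordRep_nat ω22 adm_ω22 2
  have hS := cStuffle4_mem_relations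
  have hP : KZ.of P22 = KZ.of (wordRep ω2 1 adm_ω2) * KZ.of (wordRep ω2 1 adm_ω2) := (KZ.of_mul_of _ _).symm
  have hC4 := KZ.changeOfVariablesRel_subset_relations C4_sub_mem_changeOfVariablesRel
  have h45 := fortyfive_C4_sub_eight_G4_mem
  have h3 := three_zeta_two_sub_two_G2_mem
  -- `(3 W2)² ≡ (2 Q²)²`, i.e. `9 W2² ≡ 4 Q⁴`
  have h9 : 9 • (KZ.of (wordRep ω2 1 adm_ω2) * KZ.of (wordRep ω2 1 adm_ω2)) - 4 • KZ.of G4 ∈ KZ.relations := by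
    have hm := KZ.mul_sub_mul_mem_relations h3 h3
    rw [smul_mul_smul_comm, smul_mul_smul_comm, of_G2_mul_of_G2] at hm
    exact hm
  set E := cEuler4 with hEdef
  set W4 := KZ.of (wordRep ω4 1 adm_ω4)
  set W22 := KZ.of (wordRep ω22 1 adm_ω22)
  set W2 := KZ.of (wordRep ω2 1 adm_ω2)
  set G := KZ.of G4
  set C := KZ.of C4
  have hE : E - (3 • W4 - 4 • W22) ∈ KZ.relations := by
    have : E - (3 • W4 - 4 • W22) = (KZ.of (wordRep ω4 3 adm_ω4) - 3 • W4) - (KZ.of (wordRep ω22 4 adm_ω22) - 4 • W22) := by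
      simp only [hEdef, cEuler4]; abel
    rw [this]; exact sub_mem hW4 hW22
  have hS' : W2 * W2 - 2 • W22 - W4 ∈ KZ.relations := by
    have : W2 * W2 - 2 • W22 - W4 = cStuffle4 - (-(KZ.of (wordRep ω22 2 adm_ω22) - 2 • W22)) := by
      simp only [cStuffle4, hP]; abel
    rw [this]; exact sub_mem hS (neg_mem hW22')
  have h45' : 45 • W4 - 8 • G ∈ KZ.relations := by
    have : 45 • W4 - 8 • G = (45 • C - 8 • G) - 45 • (C - W4) := by abel
    rw [this]; exact sub_mem h45 (KZ.relations.nsmul_mem hC4 45)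
  have h9E : 9 • E ∈ KZ.relations := by
    have : 9 • E = 9 • (E - (3 • W4 - 4 • W22)) + (45 • W4 - 8 • G) - 2 • (9 • (W2 * W2) - 4 • G)
        + 18 • (W2 * W2 - 2 • W22 - W4) := by abel
    rw [this]
    exact add_mem (sub_mem (add_mem (KZ.relations.nsmul_mem hE 9) h45') (KZ.relations.nsmul_mem h9 2))
      (KZ.relations.nsmul_mem hS' 18)
  exact mem_relations_of_nsmul_mem (by norm_num) h9E

/-- **THE WEIGHT-4 RUNG OF THE CRUX HOLDS, unconditionally**: every `ℤ`-combination of weight-4 MZV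
word representations with value `0` lies in `KZ.relations`. [folklore] -/
theorem weightKernel_four : WeightKernel 4 :=
  weightKernel_four_iff.mpr ⟨cFds4_mem_relations, cEuler4_mem_relations⟩

/-- Hence Hoffman's relation `ζ(4) = ζ(3,1) + ζ(2,2)` is a move chain too. [folklore] -/
theorem cHoffman4_mem_relations : cHoffman4 ∈ KZ.relations :=
  (cHoffman4_mem_iff_cEuler4_mem cFds4_mem_relations).mpr cEuler4_mem_relations

end Summit.KontsevichZagierPeriods.MzvKernelInKZ.Negative
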